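import Literature.AlgebraicGeometry.Morphisms.CechH1Projective
import Literature.AlgebraicGeometry.Motives.SegreEmbedding
import Mathlib.RingTheory.GradedAlgebra.Radical
import Mathlib.RingTheory.Nakayama
import Mathlib.RingTheory.Polynomial.Basic
import Mathlib.RingTheory.LocalRing.MaximalIdeal.Basic
import HarnessLib

/-!
# [OURS · L1 W4.5(b) · EL♮(3)] residue-1 brick R2 — coprime binary forms lift along a surjection from a local ring

Crux chain w45b (cell `res-hironaka`, slot W4.5(b)), child crux **EL♮(3)** = stmt-ResolutionOfSingularities-20148, route EquisingularLift;
research residue `stub_elnat_three_isolated_nonConeTower`, res-type-027 g15's RESIDUE-1 census (`L/res-type-027/RESIDUE1-CENSUS.md`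
faf4aafedf11a66b), first brick **R2** (signature `L/res-type-027/RESIDUE1-pieces.sig.lean` 9b43e988a6b2b6d3 l.47–53, VERBATIM): the lift of a
RATIONAL multisection's finite map `ℙ¹_k → ℙ¹_k` to `ℙ¹_O`. Written by res-D-pv-035 g9. HONEST FRAMING: OURS; NOT a statement of any manuscript;
AI-written, weaker than expert review. No `sorry`; standard axioms; DEF-FREE. `--supports stmt-ResolutionOfSingularities-20148 --as helper`.

WHAT. For the standard grading of `R[X₀, …]`:
* `irrelevant_le_radical_of_basicOpen_sup_eq_top` / `basicOpen_sup_eq_top_of_irrelevant_le_radical` — **`D₊(f) ∪ D₊(g) = Proj` iff the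
  irrelevant ideal lies in `√(f, g)`** (`f, g` homogeneous for ⇒): ⇒ because `√(f, g)` is the intersection of the HOMOGENEOUS primes above
  `(f, g)` (`Ideal.IsHomogeneous.radical_eq`) and a relevant one would be a point off both basic opens; ⇐ because a point containing `f, g`
  contains `√(f, g) ⊇ 𝒜₊`, contradicting relevance.
* `exists_isHomogeneous_map_eq` — a homogeneous form lifts along a surjection `θ : R → S` to a homogeneous form of the same degree (the
  degree-`d` component of any preimage).
* `exists_lift_coprime_binaryForms` — **R2**: binary forms `f, g` of degree `d` over a field `k` with `D₊(f) ∪ D₊(g) = ℙ¹_k` lift along a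
  surjection `θ : O → k` from a LOCAL ring to forms `f', g'` of degree `d` with `D₊(f') ∪ D₊(g') = ℙ¹_O`. Proof (graded Nakayama, no
  properness, no resultants): over `k`, `X_i^{N_i} ∈ (f, g)`; pulling back along the surjection `map θ` whose kernel is `𝔪·O[X]`
  (`MvPolynomial.ker_map`, `𝔪 = ker θ`), `X_i^{N_i} ∈ (f', g') + 𝔪·O[X]`; hence every monomial of degree `M = N₀ + N₁` lies in
  `(f', g') + 𝔪·O[X]`, and taking degree-`M` components (`(f', g')` is a homogeneous ideal; the `𝔪`-part has coefficients in `𝔪`) the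
  finitely generated `O`-module `V = O[X]_M` satisfies `V ≤ (f', g') + 𝔪 V`, so `V ≤ (f', g')` by Nakayama
  (`Submodule.le_of_le_smul_of_le_jacobson_bot`, `𝔪 ≤` Jacobson radical of the local ring `O`); thus `X_i^M ∈ (f', g')`,
  `𝒜₊ ≤ (X₀, X₁) ≤ √(f', g')` (`Segre.irrelevant_le_span_X`), and the first lemma concludes.

References (method): Stacks Project Tag 00DV (Nakayama), Tag 00JM (homogeneous radical); index only.
-/

set_option linter.dupNamespace false -- mandated namespace `Summit.<Summit>.<Problem>` of this single-conjunct summit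

noncomputable section

open AlgebraicGeometry TopologicalSpace MvPolynomial
open Literature.AlgebraicGeometry.Morphisms

/- No `attribute [local instance] MvPolynomial.gradedAlgebra` (review-lane trigger): the standard grading instance is supplied by
`letI` in each statement and proof; the elaborated statements are the same terms. -/

namespace Summit.ResolutionOfSingularities.ResolutionOfSingularities.Cruxes.EquisingularLiftNat.Sections

universe u

/-! ## 1. `D₊(f) ∪ D₊(g) = Proj` iff `𝒜₊ ≤ √(f, g)` -/

/-- **If `D₊(f) ∪ D₊(g)` is all of `Proj R[X]` then the irrelevant ideal lies in `√(f, g)`** (`f, g` homogeneous): `√(f, g)` is the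
intersection of the homogeneous primes above `(f, g)`, and a relevant one would be a point of `Proj` off both basic opens.
[folklore; Stacks Project Tag 00JM, index only] -/
theorem irrelevant_le_radical_of_basicOpen_sup_eq_top {σ : Type u} {R : Type u} [CommRing R] {f g : MvPolynomial σ R} {d e : ℕ}
    (hf : f.IsHomogeneous d) (hg : g.IsHomogeneous e)
    (h : letI := MvPolynomial.gradedAlgebra (σ := σ) (R := R)
      Proj.basicOpen (homogeneousSubmodule σ R) f ⊔ Proj.basicOpen (homogeneousSubmodule σ R) g = ⊤) :
    letI := MvPolynomial.gradedAlgebra (σ := σ) (R := R)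
    (HomogeneousIdeal.irrelevant (homogeneousSubmodule σ R)).toIdeal ≤ (Ideal.span {f, g}).radical := by
  classical
  letI := MvPolynomial.gradedAlgebra (σ := σ) (R := R)
  intro x hx
  have hhom : (Ideal.span ({f, g} : Set (MvPolynomial σ R))).IsHomogeneous (homogeneousSubmodule σ R) :=
    Ideal.homogeneous_span _ _ (by
      rintro y (rfl | rfl)
      exacts [⟨d, hf⟩, ⟨e, hg⟩])
  rw [hhom.radical_eq, Submodule.mem_sInf]
  rintro J ⟨hJhom, hle, hJprime⟩
  by_contra hxJ
  -- the relevant homogeneous prime `J` is a point of `Proj` off both basic opens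
  let P : Proj (homogeneousSubmodule σ R) :=
    { asHomogeneousIdeal := ⟨J, hJhom⟩
      isPrime := hJprime
      not_irrelevant_le := fun hle' => hxJ (hle' hx) }
  have hP : P ∈ Proj.basicOpen (homogeneousSubmodule σ R) f ⊔ Proj.basicOpen (homogeneousSubmodule σ R) g :=
    h.ge (Opens.mem_top P)
  rw [Opens.mem_sup, Proj.mem_basicOpen, Proj.mem_basicOpen] at hP
  rcases hP with hP | hP
  · exact hP (hle (Ideal.subset_span (Set.mem_insert f {g})))
  · exact hP (hle (Ideal.subset_span (Set.mem_insert_of_mem f rfl)))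

/-- **If the irrelevant ideal lies in `√(f, g)` then `D₊(f) ∪ D₊(g)` is all of `Proj R[X]`**: a point containing `f` and `g` contains
`√(f, g) ⊇ 𝒜₊`, contradicting relevance. [folklore; Stacks Project Tag 00JM, index only] -/
theorem basicOpen_sup_eq_top_of_irrelevant_le_radical {σ : Type u} {R : Type u} [CommRing R] {f g : MvPolynomial σ R}
    (h : letI := MvPolynomial.gradedAlgebra (σ := σ) (R := R)
      (HomogeneousIdeal.irrelevant (homogeneousSubmodule σ R)).toIdeal ≤ (Ideal.span {f, g}).radical) :
    letI := MvPolynomial.gradedAlgebra (σ := σ) (R := R)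
    Proj.basicOpen (homogeneousSubmodule σ R) f ⊔ Proj.basicOpen (homogeneousSubmodule σ R) g = ⊤ := by
  classical
  letI := MvPolynomial.gradedAlgebra (σ := σ) (R := R)
  refine top_le_iff.mp fun x _ => ?_
  by_contra hx
  rw [Opens.mem_sup, not_or, Proj.mem_basicOpen, Proj.mem_basicOpen, not_not, not_not] at hx
  have hspan : Ideal.span ({f, g} : Set (MvPolynomial σ R)) ≤ x.asHomogeneousIdeal.toIdeal := by
    rw [Ideal.span_le]
    rintro z (rfl | rfl)
    exacts [hx.1, hx.2]
  exact x.not_irrelevant_le fun y hy => (x.isPrime.radical_le_iff.mpr hspan) (h hy)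

/-! ## 2. Homogeneous lifts along a surjection -/

/-- **A homogeneous form lifts along a surjection to a homogeneous form of the same degree** (the degree-`d` component of any
preimage). [folklore] -/
theorem exists_isHomogeneous_map_eq {R S : Type*} [CommRing R] [CommRing S] (θ : R →+* S) (hθ : Function.Surjective θ)
    {σ : Type*} {d : ℕ} (f : MvPolynomial σ S) (hf : f.IsHomogeneous d) :
    ∃ f' : MvPolynomial σ R, f'.IsHomogeneous d ∧ MvPolynomial.map θ f' = f := by
  classical
  obtain ⟨F, hF⟩ := MvPolynomial.map_surjective θ hθ f
  refine ⟨homogeneousComponent d F, homogeneousComponent_isHomogeneous d F, ?_⟩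
  have key : MvPolynomial.map θ (homogeneousComponent d F) = homogeneousComponent d (MvPolynomial.map θ F) := by
    ext m
    simp only [coeff_map, coeff_homogeneousComponent]
    split_ifs
    · rfl
    · exact map_zero θ
  rw [key, hF, homogeneousComponent_eq_self hf]

/-! ## 3. R2 -/

/-- **R2 — coprime binary forms lift along a surjection from a local ring, staying coprime on `ℙ¹_O`.** Two binary forms `f, g` of
degree `d` over a field `k` with `D₊(f) ∪ D₊(g) = ℙ¹_k` lift along a surjection `θ : O → k` from a local ring `O` to forms `f', g'` of
degree `d` with `D₊(f') ∪ D₊(g') = ℙ¹_O`. Proof by graded Nakayama; see the module docstring.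
[OURS · L1 W4.5b · residue-1 R2 (res-type-027 `RESIDUE1-pieces.sig.lean` 9b43e988a6b2b6d3, verbatim); method: Stacks Project Tag 00DV,
index only] -/
theorem exists_lift_coprime_binaryForms {O k : Type} [CommRing O] [IsLocalRing O] [Field k] (θ : O →+* k) (hθ : Function.Surjective θ)
    (d : ℕ) (f g : MvPolynomial (Fin 2) k) (hf : f.IsHomogeneous d) (hg : g.IsHomogeneous d)
    (hcop : letI := MvPolynomial.gradedAlgebra (σ := Fin 2) (R := k)
      Proj.basicOpen (ProjCech.grading k 1) f ⊔ Proj.basicOpen (ProjCech.grading k 1) g = ⊤) :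
    letI := MvPolynomial.gradedAlgebra (σ := Fin 2) (R := O)
    ∃ f' g' : MvPolynomial (Fin 2) O, f'.IsHomogeneous d ∧ g'.IsHomogeneous d ∧ MvPolynomial.map θ f' = f ∧ MvPolynomial.map θ g' = g ∧
      Proj.basicOpen (ProjCech.grading O 1) f' ⊔ Proj.basicOpen (ProjCech.grading O 1) g' = ⊤ := by
  classical
  letI := MvPolynomial.gradedAlgebra (σ := Fin 2) (R := k)
  letI := MvPolynomial.gradedAlgebra (σ := Fin 2) (R := O)
  obtain ⟨f', hf', hff'⟩ := exists_isHomogeneous_map_eq θ hθ f hf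
  obtain ⟨g', hg', hgg'⟩ := exists_isHomogeneous_map_eq θ hθ g hg
  refine ⟨f', g', hf', hg', hff', hgg', ?_⟩
  -- over `k`: `X_i^{N_i} ∈ (f, g)`
  have hradk : (HomogeneousIdeal.irrelevant (homogeneousSubmodule (Fin 2) k)).toIdeal ≤ (Ideal.span {f, g}).radical :=
    irrelevant_le_radical_of_basicOpen_sup_eq_top hf hg hcop
  have hXk : ∀ i : Fin 2, ∃ N : ℕ, (X i : MvPolynomial (Fin 2) k) ^ N ∈ Ideal.span ({f, g} : Set (MvPolynomial (Fin 2) k)) := by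
    intro i
    have hXirr : (X i : MvPolynomial (Fin 2) k) ∈ (HomogeneousIdeal.irrelevant (homogeneousSubmodule (Fin 2) k)).toIdeal :=
      HomogeneousIdeal.mem_irrelevant_of_mem _ Nat.one_pos (isHomogeneous_X k i)
    exact Ideal.mem_radical_iff.mp (hradk hXirr)
  choose N hN using hXk
  -- the ideals `J' = (f', g')` and `𝔪 = ker θ`
  set J' : Ideal (MvPolynomial (Fin 2) O) := Ideal.span {f', g'} with hJ'
  set 𝔪 : Ideal O := RingHom.ker θ with h𝔪
  have hJ'hom : J'.IsHomogeneous (homogeneousSubmodule (Fin 2) O) :=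
    Ideal.homogeneous_span _ _ (by
      rintro y (rfl | rfl)
      exacts [⟨d, hf'⟩, ⟨d, hg'⟩])
  have hmapJ' : Ideal.map (MvPolynomial.map θ) J' = Ideal.span {f, g} := by
    rw [hJ', Ideal.map_span, Set.image_pair, hff', hgg']
  -- transfer: `X_i^{N_i} ∈ J' + 𝔪·O[X]`
  have hXO : ∀ i : Fin 2, (X i : MvPolynomial (Fin 2) O) ^ N i ∈ J' ⊔ 𝔪.map (C : O →+* MvPolynomial (Fin 2) O) := by
    intro i
    have hmem : MvPolynomial.map θ ((X i : MvPolynomial (Fin 2) O) ^ N i) ∈ Ideal.map (MvPolynomial.map θ) J' := by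
      rw [hmapJ', map_pow, map_X]
      exact hN i
    obtain ⟨y, hy, hyeq⟩ := (Ideal.mem_map_iff_of_surjective _ (MvPolynomial.map_surjective θ hθ)).mp hmem
    have hker : (X i : MvPolynomial (Fin 2) O) ^ N i - y ∈ 𝔪.map (C : O →+* MvPolynomial (Fin 2) O) := by
      rw [h𝔪, ← MvPolynomial.ker_map θ, RingHom.mem_ker, map_sub, hyeq, sub_self]
    simpa using Submodule.add_mem_sup hy hker
  -- graded Nakayama in degree `M = N₀ + N₁`
  set M : ℕ := N 0 + N 1 with hM
  set V : Submodule O (MvPolynomial (Fin 2) O) := homogeneousSubmodule (Fin 2) O M with hV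
  have hVfg : V.FG := homogeneousSubmodule_fg (Fin 2) O M
  -- every monomial of degree `M` lies in `J' + 𝔪 V`
  have key : ∀ m : Fin 2 →₀ ℕ, m.degree = M → (monomial m (1 : O)) ∈ J'.restrictScalars O ⊔ 𝔪 • V := by
    intro m hm
    -- (a) as an element of the IDEAL `J' + 𝔪·O[X]`: the monomial is a multiple of `X_0^{N_0}` or of `X_1^{N_1}`
    have hm01 : m 0 + m 1 = M := by
      rw [← hm, Finsupp.degree_eq_sum, Fin.sum_univ_two]
    have hideal : (monomial m (1 : O)) ∈ J' ⊔ 𝔪.map (C : O →+* MvPolynomial (Fin 2) O) := by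
      rcases le_or_gt (N 0) (m 0) with h0 | h0
      · have hfac : monomial m (1 : O) = X 0 ^ N 0 * monomial (m - Finsupp.single 0 (N 0)) 1 := by
          rw [X_pow_eq_monomial, monomial_mul, one_mul, add_tsub_cancel_of_le (Finsupp.single_le_iff.mpr h0)]
        rw [hfac]
        exact Ideal.mul_mem_right _ _ (hXO 0)
      · have h1 : N 1 ≤ m 1 := by omega
        have hfac : monomial m (1 : O) = X 1 ^ N 1 * monomial (m - Finsupp.single 1 (N 1)) 1 := by
          rw [X_pow_eq_monomial, monomial_mul, one_mul, add_tsub_cancel_of_le (Finsupp.single_le_iff.mpr h1)]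
        rw [hfac]
        exact Ideal.mul_mem_right _ _ (hXO 1)
    -- (b) take degree-`M` components
    obtain ⟨j, hj, c, hc, hsum⟩ := Submodule.mem_sup.mp hideal
    have hjM : homogeneousComponent M j ∈ J'.restrictScalars O := homogeneousComponent_mem_of_mem hJ'hom hj M
    have hcM : homogeneousComponent M c ∈ 𝔪 • V := by
      rw [homogeneousComponent_apply]
      refine Submodule.sum_mem _ fun m' hm' => ?_
      have hm'deg : m'.degree = M := (Finset.mem_filter.mp hm').2
      have hcoef : coeff m' c ∈ 𝔪 := (MvPolynomial.mem_map_C_iff.mp hc) m'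
      have hmon : monomial m' (coeff m' c) = coeff m' c • monomial m' (1 : O) := by
        rw [smul_monomial, smul_eq_mul, mul_one]
      rw [hmon]
      exact Submodule.smul_mem_smul hcoef (show monomial m' (1 : O) ∈ V from isHomogeneous_monomial _ hm'deg)
    have hmono : monomial m (1 : O) = homogeneousComponent M j + homogeneousComponent M c := by
      rw [← map_add, hsum, homogeneousComponent_eq_self (isHomogeneous_monomial _ hm)]
    rw [hmono]
    exact Submodule.add_mem_sup hjM hcM
  have hVle : V ≤ J'.restrictScalars O ⊔ 𝔪 • V := by
    intro p hp
    rw [p.as_sum]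
    refine Submodule.sum_mem _ fun m hm => ?_
    have hdeg : m.degree = M := by
      rw [Finsupp.degree_eq_weight_one]
      exact hp (mem_support_iff.mp hm)
    have hmon : monomial m (coeff m p) = coeff m p • monomial m (1 : O) := by
      rw [smul_monomial, smul_eq_mul, mul_one]
    rw [hmon]
    exact Submodule.smul_mem _ _ (key m hdeg)
  have h𝔪jac : 𝔪 ≤ (⊥ : Ideal O).jacobson := by
    rw [IsLocalRing.jacobson_eq_maximalIdeal ⊥ bot_ne_top]
    exact IsLocalRing.le_maximalIdeal (RingHom.ker_ne_top θ)
  have hVJ : V ≤ J'.restrictScalars O := Submodule.le_of_le_smul_of_le_jacobson_bot hVfg h𝔪jac hVle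
  -- conclude: `X_i^M ∈ J'`, so `𝒜₊ ≤ (X_0, X_1) ≤ √J'`
  have hXM : ∀ i : Fin 2, (X i : MvPolynomial (Fin 2) O) ^ M ∈ J' := fun i =>
    hVJ (show (X i : MvPolynomial (Fin 2) O) ^ M ∈ V from isHomogeneous_X_pow i M)
  have hrad : (HomogeneousIdeal.irrelevant (homogeneousSubmodule (Fin 2) O)).toIdeal ≤ J'.radical := by
    refine (Literature.AlgebraicGeometry.Motives.Segre.irrelevant_le_span_X (Fin 2) O).trans ?_
    rw [Ideal.span_le]
    rintro _ ⟨i, rfl⟩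
    exact ⟨M, hXM i⟩
  exact basicOpen_sup_eq_top_of_irrelevant_le_radical hrad

end Summit.ResolutionOfSingularities.ResolutionOfSingularities.Cruxes.EquisingularLiftNat.Sections

end
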